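import Mathlib
import HarnessLib

/-!
# Volume bound for the even-dimensional Euclidean ball

`vol B̄^{2m}(0,r) = π^m r^{2m} / m! ≤ (π e r² / m)^m`, the explicit ball-volume estimate used in
the final numerics of the counting argument (stub `stub_volume` of the line `Sketch`).
-/

set_option linter.dupNamespace false

namespace Summit.PneNP.PneNP.Theorems.LatticeMagicMagicFunctionsPersist

open MeasureTheory

/-- Volume of the closed Euclidean ball in even dimension `2m`, bounded explicitly:
`vol B̄^{2m}(0,r) = π^m r^{2m} / m! ≤ (π e r² / m)^m`, via `m^m / m! ≤ e^m`. -/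
theorem stub_volume {m : ℕ} (hm : 0 < m) {r : ℝ} (hr : 0 ≤ r) :
    volume.real (Metric.closedBall (0 : EuclideanSpace ℝ (Fin (2 * m))) r) ≤
      (Real.pi * Real.exp 1 * r ^ 2 / m) ^ m := by
  have hfin : Module.finrank ℝ (EuclideanSpace ℝ (Fin (2 * m))) = 2 * m :=
    finrank_euclideanSpace_fin
  haveI : Nontrivial (EuclideanSpace ℝ (Fin (2 * m))) :=
    Module.nontrivial_of_finrank_pos (R := ℝ) (by omega)
  rw [measureReal_def, InnerProductSpace.volume_closedBall_of_dim_even hfin, hfin,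
    ← ENNReal.ofReal_pow hr, ← ENNReal.ofReal_mul (pow_nonneg hr _),
    ENNReal.toReal_ofReal (by positivity)]
  have hmpos : (0 : ℝ) < m := by exact_mod_cast hm
  have hfact : (m : ℝ) ^ m / (m.factorial : ℝ) ≤ Real.exp 1 ^ m := by
    rw [Real.exp_one_pow]
    exact Real.pow_div_factorial_le_exp (m : ℝ) (Nat.cast_nonneg m) m
  have key : (1 : ℝ) / (m.factorial : ℝ) ≤ Real.exp 1 ^ m / (m : ℝ) ^ m := by
    rw [div_le_div_iff₀ (by positivity) (by positivity), one_mul]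
    exact (div_le_iff₀ (by positivity)).1 hfact
  calc r ^ (2 * m) * (Real.pi ^ m / (m.factorial : ℝ))
      = Real.pi ^ m * r ^ (2 * m) * (1 / (m.factorial : ℝ)) := by ring
    _ ≤ Real.pi ^ m * r ^ (2 * m) * (Real.exp 1 ^ m / (m : ℝ) ^ m) := by gcongr
    _ = (Real.pi * Real.exp 1 * r ^ 2 / m) ^ m := by
        rw [div_pow, mul_pow, mul_pow, ← pow_mul]
        ring

end Summit.PneNP.PneNP.Theorems.LatticeMagicMagicFunctionsPersist
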